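import Literature.Computability.QuantumComplexity.ForgettingDepth
import Literature.Computability.QuantumComplexity.PauliPathXEBEnumerator
import Literature.Computability.QuantumComplexity.EntropyCeiling
import HarnessLib

/-!
# The letter-diagonal XEB sandwich: the Pauli-path weight enumerator in the eigenvalues of a Pauli-diagonal noise letter
# (after Aharonov–Gao–Landau–Liu–Vazirani 2023, §5 / Theorem 4, and Kempe–Regev–Unger–de Wolf 2010, Observation 4)

Topic `Literature/Computability/QuantumComplexity` (cell `qa-dq`, D-0147; line L-18 `letter-diagonal-xeb-sandwich`,
critic PASS 2026-08-28T04:06:29Z, class VARIANT · RECORD; census: DQ-N1 letter-law currency of the L-02 records, DQ-N13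
dictionary note).  Namespace `Literature.Computability.QuantumComplexity.PauliPath` (sections `LetterXEB`,
`PauliNoiseInstance`); one module beside `PauliPathXEBEnumerator.lean` (the depolarizing records it widens:
`avgXEB_add_one_eq_weightEnumerator`, `noisyXEBSandwich`), `ForgettingDepth.lean` (the path expansion for an arbitrary
linear noise layer: `chanValueF_eq_sum`, `chanCoeff`) and `EntropyCeiling.lean` (§14, the heterogeneous Pauli noise layer
`pauliNoiseAll`).  Records R1–R4b PROVED; named facts: 0.  Pure port of the cell's scratch
`HOME/lines/letter-diagonal-xeb-sandwich/Sketch.lean` v0.2 sha16 1a842437237b3ceb (ideator qa-dq-idea-3 g0; statements and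
proofs byte-identical to the verdicted v0.1 2c75f2da36fdf42c, v0.2 = the critic's docstring folds F1/F2); only this header
block differs from the scratch.  Sources re-read on the page by the typing seat (qa-dq-lit-1 g2, `lit read`, tex chunks
pNNNN): [AharonovEtAl2023] arXiv:2211.03999 p0007 L16 Definition 1 (Pauli path integral), p0008 L21 Definition 3, L66
Definition 5 (Fourier weight), L74 Lemma 4 (total Fourier weight), p0010 L66 Lemma 5, p0016 L57–83 (§5: «the XEB of noisy
random circuits can be viewed as the Fourier weight polynomial», Theorem 4 and its proof), p0003 L7 (scope in print: «a
constant amount of depolarizing noise is applied to each qubit at each time step» — the depolarizing-only letter this module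
replaces by an arbitrary Pauli-diagonal product letter); [KempeEtAl2010] arXiv:0802.1464 p0006 L3–53 (§2: Pauli coefficients;
conjugation by a unitary is orthogonal on them), L62–75 (Observation 4: depolarizing noise on qubit j multiplies every Pauli
coefficient with S_j ≠ I by 1 − p — the one-letter case of `IsPauliDiagonal`).

The tree's XEB records for the depolarizing letter (`PauliPath.avgXEB_add_one_eq_weightEnumerator`,
`PauliPath.noisyXEBSandwich`: `E_W[XEB_γ] + 1 = Φ_C(1−γ)` and
`(1−γ)^{n(d+1)} α′ ≤ E_W XEB_γ ≤ (1−γ)^{d+1} α′`) extended to an ARBITRARY PAULI-DIAGONAL noise layer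
`N` (a linear map acting on every Pauli string `T` by a scalar `Π_i λ_i(T_i)`, heterogeneous over the
wires): (R1) the letter damping identity `Tr(O N(E_d)) = Σ_s λ^s f(C,s)` with
`λ^s = Π_{t,i} λ_i(s_t(i))`; (R2) the frame identity `E_W[XEB_N] + 1 = Σ_s λ^s w_s` with
`w_s = (2ⁿ)² |f(C,s,x₀)|² ≥ 0` (the weight enumerator in the letter's eigenvalues); (R3) the sandwich
`λ_min^{n(d+1)} α′ ≤ E_W XEB_N ≤ λ_max^{d+1} α′` for REAL tables with `λ_i(I) = 1` and
`0 ≤ λ_min ≤ λ_i(P) ≤ λ_max ≤ 1` (`P ≠ I`); (R4) instances with their validity ranges (Pauli letter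
laws: `λ(P) = 1 − 2(q_A + q_B)`, `{A, B}` the letters anticommuting with `P`; the tree's heterogeneous
Pauli noise layer `EntropyCeiling.pauliNoiseAll` IS Pauli-diagonal with that table).

HONEST SCOPE. Pauli-diagonal letters only (Pauli letter laws incl. biased / dephasing-dominated
noise; depolarizing = the tree's case, recovered verbatim). A NON-unital letter such as amplitude
damping is NOT covered: its creation term `I ↦ Z` couples to the circuit beyond the path weights.
DICTIONARY ONLY: randomized compiling maps a device letter to its Pauli twirl ON AVERAGE over the
frame; e.g. the twirl of amplitude damping `𝒜_q` has the table `(λ_X, λ_Y, λ_Z) =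
(√(1−q), √(1−q), 1−q)` (read off `ForgettingDepth.heisLoc_adKraus`) — no statement below is about
the untwirled device. The ceiling exponent `d + 1` is one non-identity letter per layer on a
contributing path (`pathCoeff_eq_zero_of_not_layerLegal`); the floor exponent `n(d+1)` counts all
noise locations and is positivity-grade. For pure dephasing (`λ_Z = 1`) the ceiling is VACUOUS.
Nothing here proves or refutes quantum advantage; identities and bounds about the honest noisy
device scored against its own ideal circuit; no simulator or spoofer is built.
-/

noncomputable section

open Matrix Finset
open Literature.Barriers.QuantumAdvantage (linearXEB)

namespace Literature.Computability.QuantumComplexity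

namespace PauliPath

open ForgettingDepth

variable {ι : Type*} [Fintype ι] [DecidableEq ι]

section LetterXEB

variable (N : Matrix (ι → Bool) (ι → Bool) ℂ →ₗ[ℂ] Matrix (ι → Bool) (ι → Bool) ℂ)

/-- A linear map is PAULI-DIAGONAL with (per-wire, i.e. PRODUCT) eigenvalue table
`λ : ι → Pauli → ℂ` when every Pauli coefficient is rescaled:
`Tr(T · N(M)) = (Π_i λ_i(T_i)) · Tr(T · M)` (the transfer matrix is diagonal in the Pauli basis with
product entries); equivalently (Schrödinger form, by Pauli expansion and linearity)
`N(P_S) = (Π_i λ_i(S_i)) · P_S` for every Pauli string `S`. The normalisation `λ_i(I) = 1` is NOT part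
of the definition (it is an explicit hypothesis of (R3) and holds for the instances below).
[cite: AharonovEtAl2023, §2 (sentence before Definition 2: ℰ(I) = I, ℰ(P) = (1−γ)P)] -/
def IsPauliDiagonal (lam : ι → Pauli → ℂ) : Prop :=
  ∀ (M : Matrix (ι → Bool) (ι → Bool) ℂ) (T : ι → Pauli),
    (pauliString T * N M).trace = (∏ i, lam i (T i)) * (pauliString T * M).trace

/-- The LETTER WEIGHT `λ^s = Π_t Π_i λ_i(s_t(i))` of a Pauli path (all `d + 1` labels).
[cite: AharonovEtAl2023, §2 (display after Definition 2: f̃(C,s,x) = (1−γ)^{|s|} f(C,s,x))] -/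
def letterWeight (lam : ι → Pauli → ℂ) {d : ℕ} (s : Fin (d + 1) → ι → Pauli) : ℂ :=
  ∏ t, ∏ i, lam i (s t i)

variable {N}

/-- The transition amplitude through a Pauli-diagonal layer is the noiseless one times the letter
factor of the OUTPUT label: `Tr(T N(U S U†)) = λ(T) · Tr(T U S U†)`.
[cite: AharonovEtAl2023, §2 (proof of Lemma 2: peel one layer; path expansion)] -/
theorem chanAmp_eq_of_isPauliDiagonal {lam : ι → Pauli → ℂ} (hN : IsPauliDiagonal N lam)
    (U : Matrix (ι → Bool) (ι → Bool) ℂ) (S T : ι → Pauli) :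
    chanAmp N U S T = (∏ i, lam i (T i)) * transAmp 0 U S T := by
  rw [chanAmp, hN, transAmp, depolarizeAll_rate_zero]

/-- The path coefficient through Pauli-diagonal layers is the letter weight times the noiseless
Fourier coefficient: `chanCoeff N = λ^s · f(C,s)`.
[cite: AharonovEtAl2023, §2 (display after Definition 2: f̃ = (1−γ)^{|s|} f)] -/
theorem chanCoeff_eq_letterWeight_mul_pathCoeff {lam : ι → Pauli → ℂ} (hN : IsPauliDiagonal N lam)
    {d : ℕ} (U : Fin d → Matrix (ι → Bool) (ι → Bool) ℂ) (ρ O : Matrix (ι → Bool) (ι → Bool) ℂ)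
    (s : Fin (d + 1) → ι → Pauli) :
    chanCoeff N U ρ (obsFun O) s = letterWeight lam s * pathCoeff 0 U ρ O s := by
  have hobs : ∀ X, obsFun O X = (O * X).trace := fun X => rfl
  have hprod : ∏ t : Fin d, chanAmp N (U t) (s t.castSucc) (s t.succ) =
      (∏ t : Fin d, ∏ i, lam i (s t.succ i)) * ∏ t : Fin d, transAmp 0 (U t) (s t.castSucc) (s t.succ) := by
    rw [← Finset.prod_mul_distrib]
    exact Finset.prod_congr rfl fun t _ => chanAmp_eq_of_isPauliDiagonal hN _ _ _
  rw [chanCoeff, pathCoeff, hobs, hprod, hN ρ (s 0), depolarizeAll_rate_zero, letterWeight,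
    Fin.prod_univ_succ (fun t => ∏ i, lam i (s t i))]
  ring

/-- **(R1) LETTER DAMPING IDENTITY** `Tr(O · N(E_d)) = Σ_s λ^s · f(C,s)` for every Pauli-diagonal
linear noise layer (any layer matrices, input and read-out).
[cite: AharonovEtAl2023, §1.1 (display: p̃(C,x) = Σ_s (1−γ)^{|s|} f(C,s,x)) and Lemma 2] -/
theorem chanValue_eq_sum_letterWeight_mul_pathCoeff {lam : ι → Pauli → ℂ} (hN : IsPauliDiagonal N lam)
    {d : ℕ} (U : Fin d → Matrix (ι → Bool) (ι → Bool) ℂ) (ρ O : Matrix (ι → Bool) (ι → Bool) ℂ) :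
    chanValue N U ρ O = ∑ s : Fin (d + 1) → ι → Pauli, letterWeight lam s * pathCoeff 0 U ρ O s := by
  rw [chanValue_eq_chanValueF, chanValueF_eq_sum]
  exact Finset.sum_congr rfl fun s _ => chanCoeff_eq_letterWeight_mul_pathCoeff hN U ρ O s

/-- The depolarizing table `λ(I) = 1`, `λ(P) = 1 − γ` (`P ≠ I`), real rate.
[cite: AharonovEtAl2023, §2 (sentence before Definition 2)] -/
def depolTable (γ : ℝ) : ι → Pauli → ℝ := fun _ P => if P = Pauli.I then 1 else 1 - γ

/-- The complex table of a real table. [folklore] -/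
def tableC (lam : ι → Pauli → ℝ) : ι → Pauli → ℂ := fun i P => (lam i P : ℂ)

/-- The real letter weight `λ^s` of a real table. [cite: AharonovEtAl2023, §2 (display after Definition 2)] -/
def letterWeightR (lam : ι → Pauli → ℝ) {d : ℕ} (s : Fin (d + 1) → ι → Pauli) : ℝ :=
  ∏ t, ∏ i, lam i (s t i)

omit [DecidableEq ι] in
/-- `λ^s` of the complexified table is the cast of the real letter weight.
[cite: AharonovEtAl2023, §2 (display after Definition 2: f̃(C,s,x) = (1−γ)^{|s|} f(C,s,x) ∈ ℝ)] -/
theorem letterWeight_tableC (lam : ι → Pauli → ℝ) {d : ℕ} (s : Fin (d + 1) → ι → Pauli) :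
    letterWeight (tableC lam) s = ((letterWeightR lam s : ℝ) : ℂ) := by
  simp only [letterWeight, letterWeightR, tableC, Complex.ofReal_prod]

omit [DecidableEq ι] in
/-- The product of the depolarizing table over a string is `(1−γ)^{|T|}`.
[cite: AharonovEtAl2023, §2 (Definition 2: ℰ^{⊗n}(s) = (1−γ)^{|s|} s)] -/
theorem prod_tableC_depolTable (γ : ℝ) (T : ι → Pauli) :
    ∏ i, tableC (depolTable (ι := ι) γ) i (T i) = (1 - (γ : ℂ)) ^ strWeight T := by
  have h : ∀ i, tableC (depolTable (ι := ι) γ) i (T i) = if T i = Pauli.I then (1 : ℂ) else 1 - (γ : ℂ) := by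
    intro i
    unfold tableC depolTable
    split_ifs <;> push_cast <;> rfl
  simp only [h, Finset.prod_ite, Finset.prod_const_one, one_mul, Finset.prod_const, strWeight_eq, ne_eq]

/-- **Instance: the depolarizing layer is Pauli-diagonal** with the depolarizing table.
[cite: AharonovEtAl2023, §2 (Definition 2: ℰ^{⊗n}(s) = (1−γ)^{|s|} s)] -/
theorem isPauliDiagonal_depolarizeAllL (γ : ℝ) :
    IsPauliDiagonal (depolarizeAllL (ι := ι) (γ : ℂ)) (tableC (depolTable γ)) := by
  intro M T
  rw [prod_tableC_depolTable, depolarizeAllL_apply, ← pauliCoeff_eq, ← pauliCoeff_eq,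
    pauliCoeff_depolarizeAll]

omit [DecidableEq ι] in
/-- The depolarizing letter weight is `(1−γ)^{|s|}`.
[cite: AharonovEtAl2023, §2 (display after Definition 2)] -/
theorem letterWeightR_depolTable (γ : ℝ) {d : ℕ} (s : Fin (d + 1) → ι → Pauli) :
    letterWeightR (depolTable (ι := ι) γ) s = (1 - γ) ^ pathWeight s := by
  classical
  unfold letterWeightR
  rw [pathWeight_eq, ← Finset.prod_pow_eq_pow_sum]
  refine Finset.prod_congr rfl fun t _ => ?_
  simp only [depolTable, Finset.prod_ite, Finset.prod_const_one, one_mul, Finset.prod_const,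
    strWeight_eq, ne_eq]

/-! ### (R2) The frame identity: XEB in the letter's eigenvalues -/

/-- **(R2, complex form)** `2ⁿ Σ_W Σ_x p_W(x) · Tr(x · N(E_d(C_W))) = F · Σ_s λ^s (2ⁿ f(C,s,x₀))²`:
the noiseless path expansion for the ideal device, (R1) for the letter device, and the tree's
bilinear frame orthogonality with profiles `a_s = 1`, `b_s = λ^s`.
[cite: AharonovEtAl2023, §5 (display before Theorem 4) and Lemma 3] -/
theorem two_pow_mul_sum_frame_sum_noisyValue_zero_mul_chanValue {lam : ι → Pauli → ℂ}
    (hN : IsPauliDiagonal N lam) {d : ℕ} (U : Fin d → Matrix (ι → Bool) (ι → Bool) ℂ)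
    (ρ : Matrix (ι → Bool) (ι → Bool) ℂ) (x₀ : ι → Bool) :
    (2 : ℂ) ^ Fintype.card ι * ∑ W : Fin (d + 1) → ι → Pauli, ∑ x : ι → Bool,
        noisyValue 0 (frameLayers U W) ρ (frameObs (proj x) W) *
          chanValue N (frameLayers U W) ρ (frameObs (proj x) W) =
      ((4 : ℂ) ^ Fintype.card ι) ^ (d + 1) *
        ∑ s : Fin (d + 1) → ι → Pauli,
          letterWeight lam s * (((2 : ℂ) ^ Fintype.card ι) ^ 2 * pathCoeff 0 U ρ (proj x₀) s ^ 2) := by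
  have h := sum_frame_sum_pathSum_mul_pathSum (fun _ => (1 : ℂ)) (letterWeight lam) U ρ x₀
  simp only [one_mul] at h
  simp only [noisyValue_eq_sum_pathCoeff, chanValue_eq_sum_letterWeight_mul_pathCoeff hN]
  exact h

/-- Letter-noisy output value `Re Tr(|x⟩⟨x| · N(E_d(C_W)))` of the framed circuit on the basis input
`|y⟩⟨y|` (real for a real table, `ofReal_letterOut`). [cite: AharonovEtAl2023, Definition 1 (p̃(C,x))] -/
def letterOut (N : Matrix (ι → Bool) (ι → Bool) ℂ →ₗ[ℂ] Matrix (ι → Bool) (ι → Bool) ℂ)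
    {d : ℕ} (U : Fin d → Matrix (ι → Bool) (ι → Bool) ℂ) (y : ι → Bool)
    (W : Fin (d + 1) → ι → Pauli) (x : ι → Bool) : ℝ :=
  (chanValue N (frameLayers U W) (proj y) (frameObs (proj x) W)).re

/-- Linear XEB score of the honest letter-noisy device against its own ideal distribution in frame
`W`. [cite: AharonovEtAl2023, §5 (display defining the linear cross entropy)] -/
def letterXEB (N : Matrix (ι → Bool) (ι → Bool) ℂ →ₗ[ℂ] Matrix (ι → Bool) (ι → Bool) ℂ)
    {d : ℕ} (U : Fin d → Matrix (ι → Bool) (ι → Bool) ℂ) (y : ι → Bool)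
    (W : Fin (d + 1) → ι → Pauli) : ℝ :=
  linearXEB (idealOut U y W) (letterOut N U y W)

/-- Frame-averaged letter-noisy XEB score `E_W XEB_N`.
[cite: AharonovEtAl2023, §5 (display before Theorem 4)] -/
def letterAvgXEB (N : Matrix (ι → Bool) (ι → Bool) ℂ →ₗ[ℂ] Matrix (ι → Bool) (ι → Bool) ℂ)
    {d : ℕ} (U : Fin d → Matrix (ι → Bool) (ι → Bool) ℂ) (y : ι → Bool) : ℝ :=
  (∑ W : Fin (d + 1) → ι → Pauli, letterXEB N U y W) / frameCount ι d

/-- The squared, normalised noiseless Fourier coefficient `w_s = (2ⁿ)² |f(C,s,x₀)|² ≥ 0` of one path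
(the summand of `W_k`). [cite: AharonovEtAl2023, Definition 5] -/
def pathSqWeight {d : ℕ} (U : Fin d → Matrix (ι → Bool) (ι → Bool) ℂ) (y x₀ : ι → Bool)
    (s : Fin (d + 1) → ι → Pauli) : ℝ :=
  ((2 : ℝ) ^ Fintype.card ι) ^ 2 * ‖pathCoeff 0 U (proj y) (proj x₀) s‖ ^ 2

/-- The LETTER ENUMERATOR `Σ_s λ^s w_s` (the weight enumerator `Φ_C` with the variable `t^{|s|}`
replaced by the letter weight `λ^s`). [cite: AharonovEtAl2023, §5 (display before Theorem 4: Σ_k (1−γ)^k W_k)] -/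
def letterEnumerator (lam : ι → Pauli → ℝ) {d : ℕ} (U : Fin d → Matrix (ι → Bool) (ι → Bool) ℂ)
    (y x₀ : ι → Bool) : ℝ :=
  ∑ s : Fin (d + 1) → ι → Pauli, letterWeightR lam s * pathSqWeight U y x₀ s

/-- A complex number fixed by conjugation has `z² = |z|²`. [folklore] -/
private theorem sq_eq_ofReal_norm_sq₃ {z : ℂ} (hz : (starRingEnd ℂ) z = z) :
    z ^ 2 = ((‖z‖ ^ 2 : ℝ) : ℂ) := by
  obtain ⟨t, rfl⟩ : ∃ t : ℝ, (t : ℂ) = z := ⟨z.re, Complex.conj_eq_iff_re.mp hz⟩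
  rw [Complex.norm_real, Real.norm_eq_abs, sq_abs]
  push_cast
  ring

/-- The framed basis read-out is Hermitian. [cite: AharonovEtAl2023, Definition 3 (final layer)] -/
theorem conjTranspose_frameObs_proj {d : ℕ} (x : ι → Bool) (W : Fin (d + 1) → ι → Pauli) :
    (frameObs (proj x) W)ᴴ = frameObs (proj x) W := by
  simp only [frameObs, Matrix.conjTranspose_mul, conjTranspose_pauliString, conjTranspose_proj,
    Matrix.mul_assoc]

/-- The letter-noisy framed value on a basis input with basis read-out is REAL for a real table.
[cite: AharonovEtAl2023, §2 (display after Definition 2: f(C,s,x) ∈ ℝ)] -/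
theorem ofReal_letterOut {lam : ι → Pauli → ℝ} (hN : IsPauliDiagonal N (tableC lam)) {d : ℕ}
    (U : Fin d → Matrix (ι → Bool) (ι → Bool) ℂ) (y : ι → Bool) (W : Fin (d + 1) → ι → Pauli)
    (x : ι → Bool) :
    ((letterOut N U y W x : ℝ) : ℂ) = chanValue N (frameLayers U W) (proj y) (frameObs (proj x) W) := by
  unfold letterOut
  refine Complex.conj_eq_iff_re.mp ?_
  rw [chanValue_eq_sum_letterWeight_mul_pathCoeff hN, map_sum]
  refine Finset.sum_congr rfl fun s _ => ?_
  rw [map_mul, letterWeight_tableC, Complex.conj_ofReal,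
    conj_pathCoeff_zero _ (conjTranspose_proj y) (conjTranspose_frameObs_proj x W)]

/-- Unfolding of the letter frame score: `XEB_N(W) = 2ⁿ Σ_x p_W(x) p̃_W(x) − 1`.
[cite: AharonovEtAl2023, §5 (display defining the linear cross entropy)] -/
theorem letterXEB_eq (N : Matrix (ι → Bool) (ι → Bool) ℂ →ₗ[ℂ] Matrix (ι → Bool) (ι → Bool) ℂ)
    {d : ℕ} (U : Fin d → Matrix (ι → Bool) (ι → Bool) ℂ) (y : ι → Bool) (W : Fin (d + 1) → ι → Pauli) :
    letterXEB N U y W =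
      (2 : ℝ) ^ Fintype.card ι * ∑ x, idealOut U y W x * letterOut N U y W x - 1 := by
  simp only [letterXEB, linearXEB, Fintype.card_fun, Fintype.card_bool]
  push_cast
  ring

/-- The frame-summed letter score. [cite: AharonovEtAl2023, §5 (display before Theorem 4, first line)] -/
theorem sum_letterXEB_eq (N : Matrix (ι → Bool) (ι → Bool) ℂ →ₗ[ℂ] Matrix (ι → Bool) (ι → Bool) ℂ)
    {d : ℕ} (U : Fin d → Matrix (ι → Bool) (ι → Bool) ℂ) (y : ι → Bool) :
    ∑ W : Fin (d + 1) → ι → Pauli, letterXEB N U y W =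
      (2 : ℝ) ^ Fintype.card ι * ∑ W : Fin (d + 1) → ι → Pauli, ∑ x,
        idealOut U y W x * letterOut N U y W x - frameCount ι d := by
  rw [← card_frame_eq (ι := ι) d]
  simp only [letterXEB_eq, Finset.sum_sub_distrib, Finset.mul_sum, Finset.sum_const, Finset.card_univ,
    nsmul_eq_mul, mul_one]

/-- **(R2) `E_W[XEB_N] + 1 = Σ_s λ^s w_s`** — the frame-averaged honest letter-noisy XEB score plus one
is the letter enumerator (any layer matrices, any basis input `y`, any reference output `x₀`).
[cite: AharonovEtAl2023, §5 (display before Theorem 4), arXiv p. 16] -/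
theorem letterAvgXEB_add_one_eq {lam : ι → Pauli → ℝ} (hN : IsPauliDiagonal N (tableC lam)) {d : ℕ}
    (U : Fin d → Matrix (ι → Bool) (ι → Bool) ℂ) (y x₀ : ι → Bool) :
    letterAvgXEB N U y + 1 = letterEnumerator lam U y x₀ := by
  have hF := frameCount_pos ι d
  have hC := two_pow_mul_sum_frame_sum_noisyValue_zero_mul_chanValue hN U (proj y) x₀
  have hL : (((2 : ℝ) ^ Fintype.card ι * ∑ W : Fin (d + 1) → ι → Pauli, ∑ x : ι → Bool,
      idealOut U y W x * letterOut N U y W x : ℝ) : ℂ) =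
      (2 : ℂ) ^ Fintype.card ι * ∑ W : Fin (d + 1) → ι → Pauli, ∑ x : ι → Bool,
        noisyValue 0 (frameLayers U W) (proj y) (frameObs (proj x) W) *
          chanValue N (frameLayers U W) (proj y) (frameObs (proj x) W) := by
    push_cast
    simp_rw [ofReal_idealOut, ofReal_letterOut hN]
  have hR : ((frameCount ι d * letterEnumerator lam U y x₀ : ℝ) : ℂ) =
      ((4 : ℂ) ^ Fintype.card ι) ^ (d + 1) *
        ∑ s : Fin (d + 1) → ι → Pauli,
          letterWeight (tableC lam) s * (((2 : ℂ) ^ Fintype.card ι) ^ 2 * pathCoeff 0 U (proj y) (proj x₀) s ^ 2) := by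
    unfold frameCount letterEnumerator pathSqWeight
    push_cast
    refine congrArg _ (Finset.sum_congr rfl fun s _ => ?_)
    rw [letterWeight_tableC,
      sq_eq_ofReal_norm_sq₃ (conj_pathCoeff_zero U (conjTranspose_proj y) (conjTranspose_proj x₀) s)]
    push_cast
    ring
  have hreal : (2 : ℝ) ^ Fintype.card ι * ∑ W : Fin (d + 1) → ι → Pauli, ∑ x : ι → Bool,
      idealOut U y W x * letterOut N U y W x = frameCount ι d * letterEnumerator lam U y x₀ := by
    exact_mod_cast hL.trans (hC.trans hR.symm)
  rw [letterAvgXEB, sum_letterXEB_eq, hreal]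
  field_simp
  ring

/-- **Consistency with the tree's depolarizing records**: the letter score of `depolarizeAllL γ` is
`avgXEB γ`. [cite: AharonovEtAl2023, §5 (display before Theorem 4)] -/
theorem letterAvgXEB_depolarizeAllL (γ : ℝ) {d : ℕ} (U : Fin d → Matrix (ι → Bool) (ι → Bool) ℂ)
    (y : ι → Bool) : letterAvgXEB (depolarizeAllL (γ : ℂ)) U y = avgXEB γ U y := by
  have h : ∀ W : Fin (d + 1) → ι → Pauli, letterOut (depolarizeAllL (γ : ℂ)) U y W = noisyOut γ U y W := by
    intro W
    funext x
    simp only [letterOut, noisyOut, chanValue_depolarizeAllL]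
  simp only [letterAvgXEB, letterXEB, avgXEB, frameXEB, h]

/-- **The tree's record as an instance**: `E_W[XEB_γ] + 1 = Σ_s (1−γ)^{|s|} w_s`.
[cite: AharonovEtAl2023, §5 (display before Theorem 4: XEB = Σ_{k>0} (1−γ)^k W_k)] -/
theorem avgXEB_add_one_eq_letterEnumerator (γ : ℝ) {d : ℕ} (U : Fin d → Matrix (ι → Bool) (ι → Bool) ℂ)
    (y x₀ : ι → Bool) : avgXEB γ U y + 1 = letterEnumerator (depolTable γ) U y x₀ := by
  rw [← letterAvgXEB_depolarizeAllL γ U y]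
  exact letterAvgXEB_add_one_eq (isPauliDiagonal_depolarizeAllL γ) U y x₀

/-- `α′ + 1 = Σ_s w_s`: the ideal mean score plus one is the total path weight.
[cite: AharonovEtAl2023, Lemma 4 (proof: E_C 2ⁿ Σ_x p(C,x)² = Σ_k W_k)] -/
theorem avgXEB_zero_add_one_eq_sum_pathSqWeight {d : ℕ} (U : Fin d → Matrix (ι → Bool) (ι → Bool) ℂ)
    (y x₀ : ι → Bool) : avgXEB 0 U y + 1 = ∑ s : Fin (d + 1) → ι → Pauli, pathSqWeight U y x₀ s := by
  rw [avgXEB_add_one_eq_letterEnumerator 0 U y x₀, letterEnumerator]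
  refine Finset.sum_congr rfl fun s _ => ?_
  rw [letterWeightR_depolTable, sub_zero, one_pow, one_mul]

/-! ### (R3) The letter sandwich -/

/-- `w_s ≥ 0`. [cite: AharonovEtAl2023, Definition 5] -/
theorem pathSqWeight_nonneg {d : ℕ} (U : Fin d → Matrix (ι → Bool) (ι → Bool) ℂ) (y x₀ : ι → Bool)
    (s : Fin (d + 1) → ι → Pauli) : 0 ≤ pathSqWeight U y x₀ s := by
  unfold pathSqWeight; positivity

/-- `w_{I…I} = 1` for unitary layers. [cite: AharonovEtAl2023, Lemma 4 (item 1)] -/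
theorem pathSqWeight_const_I {d : ℕ} {U : Fin d → Matrix (ι → Bool) (ι → Bool) ℂ}
    (hU : ∀ t, U t ∈ Matrix.unitaryGroup (ι → Bool) ℂ) (y x₀ : ι → Bool) :
    pathSqWeight U y x₀ (fun _ _ => Pauli.I) = 1 := by
  have h := fourierWeight_zero 0 hU x₀ y
  rw [sq_eq_ofReal_norm_sq₃ (conj_pathCoeff_zero U (conjTranspose_proj y) (conjTranspose_proj x₀) _)] at h
  unfold pathSqWeight
  exact_mod_cast h

omit [DecidableEq ι] in
/-- A path all of whose layers carry a non-identity letter has letter weight at most `λ_max^{d+1}`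
when `0 ≤ λ ≤ 1` sitewise and `λ_i(P) ≤ λ_max` off the identity.
[cite: AharonovEtAl2023, Lemma 4 (item 2, proof)] -/
theorem letterWeightR_le_pow_of_forall_ne {lam : ι → Pauli → ℝ} {ν : ℝ}
    (h0 : ∀ i P, 0 ≤ lam i P) (h1 : ∀ i P, lam i P ≤ 1) (hhi : ∀ i P, P ≠ Pauli.I → lam i P ≤ ν)
    {d : ℕ} {s : Fin (d + 1) → ι → Pauli} (hs : ∀ t, s t ≠ fun _ => Pauli.I) :
    letterWeightR lam s ≤ ν ^ (d + 1) := by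
  classical
  have hlayer : ∀ t, ∏ i, lam i (s t i) ≤ ν := by
    intro t
    obtain ⟨i₀, hi₀⟩ : ∃ i, s t i ≠ Pauli.I := by
      by_contra h
      push Not at h
      exact hs t (funext h)
    rw [← Finset.mul_prod_erase Finset.univ (fun i => lam i (s t i)) (Finset.mem_univ i₀)]
    have hν : 0 ≤ ν := (h0 i₀ (s t i₀)).trans (hhi i₀ _ hi₀)
    calc lam i₀ (s t i₀) * ∏ i ∈ Finset.univ.erase i₀, lam i (s t i)
        ≤ ν * 1 := mul_le_mul (hhi i₀ _ hi₀)
            (Finset.prod_le_one (fun i _ => h0 i _) (fun i _ => h1 i _))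
            (Finset.prod_nonneg fun i _ => h0 i _) hν
      _ = ν := mul_one ν
  calc letterWeightR lam s = ∏ t, ∏ i, lam i (s t i) := rfl
    _ ≤ ∏ _t : Fin (d + 1), ν :=
        Finset.prod_le_prod (fun t _ => Finset.prod_nonneg fun i _ => h0 i _) (fun t _ => hlayer t)
    _ = ν ^ (d + 1) := by rw [Finset.prod_const, Finset.card_univ, Fintype.card_fin]

/-- A contributing non-identity path has NO identity layer (unitary layers, the tree's layer
legality), hence its letter weight is at most `λ_max^{d+1}`.
[cite: AharonovEtAl2023, Lemma 4 (item 2, proof) and Lemma 5] -/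
theorem letterWeightR_le_pow_of_pathSqWeight_ne_zero {lam : ι → Pauli → ℝ} {ν : ℝ}
    (h0 : ∀ i P, 0 ≤ lam i P) (h1 : ∀ i P, lam i P ≤ 1) (hhi : ∀ i P, P ≠ Pauli.I → lam i P ≤ ν)
    {d : ℕ} {U : Fin d → Matrix (ι → Bool) (ι → Bool) ℂ} (hU : ∀ t, U t ∈ Matrix.unitaryGroup (ι → Bool) ℂ)
    (y x₀ : ι → Bool) {s : Fin (d + 1) → ι → Pauli} (hs : s ≠ fun _ _ => Pauli.I)
    (hw : pathSqWeight U y x₀ s ≠ 0) : letterWeightR lam s ≤ ν ^ (d + 1) := by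
  have hc : pathCoeff 0 U (proj y) (proj x₀) s ≠ 0 := by
    intro h
    apply hw
    rw [pathSqWeight, h, norm_zero, zero_pow two_ne_zero, mul_zero]
  have hleg : LayerLegal s := by
    by_contra h
    exact hc (pathCoeff_eq_zero_of_not_layerLegal 0 hU (proj y) (proj x₀) h)
  rcases layerLegal_dichotomy hleg with h | h
  · exact absurd (funext h) hs
  · exact letterWeightR_le_pow_of_forall_ne h0 h1 hhi h

omit [DecidableEq ι] in
/-- Every letter weight is at least `λ_min^{n(d+1)}` when `0 ≤ λ_min ≤ λ` sitewise.
[cite: AharonovEtAl2023, §3.2 (n(d+1) possible locations) and Theorem 4 (lower bound)] -/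
theorem pow_le_letterWeightR {lam : ι → Pauli → ℝ} {μ : ℝ} (hμ : 0 ≤ μ) (hlo : ∀ i P, μ ≤ lam i P)
    {d : ℕ} (s : Fin (d + 1) → ι → Pauli) :
    μ ^ (Fintype.card ι * (d + 1)) ≤ letterWeightR lam s := by
  calc μ ^ (Fintype.card ι * (d + 1)) = ∏ _t : Fin (d + 1), ∏ _i : ι, μ := by
        rw [Finset.prod_const, Finset.prod_const, Finset.card_univ, Finset.card_univ, Fintype.card_fin,
          pow_mul]
    _ ≤ ∏ t, ∏ i, lam i (s t i) :=
        Finset.prod_le_prod (fun t _ => Finset.prod_nonneg fun i _ => hμ) fun t _ =>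
          Finset.prod_le_prod (fun i _ => hμ) fun i _ => hlo i _
    _ = letterWeightR lam s := rfl

omit [DecidableEq ι] in
/-- The identity path has letter weight `1` when `λ_i(I) = 1`. [cite: AharonovEtAl2023, Lemma 4 (item 1)] -/
theorem letterWeightR_const_I {lam : ι → Pauli → ℝ} (hI : ∀ i, lam i Pauli.I = 1) (d : ℕ) :
    letterWeightR lam (fun (_ : Fin (d + 1)) (_ : ι) => Pauli.I) = 1 := by
  simp only [letterWeightR, hI, Finset.prod_const_one]

/-- **(R3) LETTER SANDWICH** `λ_min^{n(d+1)} · α′ ≤ E_W XEB_N ≤ λ_max^{d+1} · α′` (`α′ = E_W XEB_0`)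
for unitary layers and a Pauli-diagonal noise layer with a REAL table satisfying `λ_i(I) = 1` and
`0 ≤ λ_min ≤ λ_i(P) ≤ λ_max ≤ 1` for `P ≠ I`. The ceiling exponent `d + 1` = one non-identity letter
per layer on every contributing path (`pathCoeff_eq_zero_of_not_layerLegal`); the floor exponent
`n(d+1)` = all noise locations (a positivity-grade bound). For pure dephasing (`λ_Z = 1`) the
ceiling is VACUOUS (`λ_max = 1`). Biased noise enters ONLY through the envelope `(λ_min, λ_max)`:
the record does not say that bias helps or hurts the device's score (at equal flip mass a biased
table has the larger `λ_max`, so its typed CEILING is the weaker statement — `letterSandwich_numbers`).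
The depolarizing table gives the tree's `noisyXEBSandwich` (`letterXEBSandwich_depolTable`).
[cite: AharonovEtAl2023, Theorem 4 (proof) and Lemma 4 (items 1–2)] -/
theorem letterXEBSandwich {lam : ι → Pauli → ℝ} (hN : IsPauliDiagonal N (tableC lam))
    (hI : ∀ i, lam i Pauli.I = 1) {μ ν : ℝ} (hμ : 0 ≤ μ) (hμν : μ ≤ ν) (hν : ν ≤ 1)
    (hlo : ∀ i P, P ≠ Pauli.I → μ ≤ lam i P) (hhi : ∀ i P, P ≠ Pauli.I → lam i P ≤ ν)
    {d : ℕ} {U : Fin d → Matrix (ι → Bool) (ι → Bool) ℂ} (hU : ∀ t, U t ∈ Matrix.unitaryGroup (ι → Bool) ℂ)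
    (y : ι → Bool) :
    μ ^ (Fintype.card ι * (d + 1)) * avgXEB 0 U y ≤ letterAvgXEB N U y ∧
      letterAvgXEB N U y ≤ ν ^ (d + 1) * avgXEB 0 U y := by
  classical
  have h0 : ∀ i P, 0 ≤ lam i P := fun i P => by
    by_cases hP : P = Pauli.I
    · rw [hP, hI]; exact zero_le_one
    · exact hμ.trans (hlo i P hP)
  have h1 : ∀ i P, lam i P ≤ 1 := fun i P => by
    by_cases hP : P = Pauli.I
    · rw [hP, hI]
    · exact (hhi i P hP).trans hν
  have hlo' : ∀ i P, μ ≤ lam i P := fun i P => by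
    by_cases hP : P = Pauli.I
    · rw [hP, hI]; exact hμν.trans hν
    · exact hlo i P hP
  set s₀ : Fin (d + 1) → ι → Pauli := fun _ _ => Pauli.I with hs₀
  have hL := letterAvgXEB_add_one_eq hN U y y
  have hA := avgXEB_zero_add_one_eq_sum_pathSqWeight U y y
  rw [letterEnumerator, ← Finset.add_sum_erase _ _ (Finset.mem_univ s₀), letterWeightR_const_I hI,
    pathSqWeight_const_I hU, one_mul] at hL
  rw [← Finset.add_sum_erase _ _ (Finset.mem_univ s₀), pathSqWeight_const_I hU] at hA
  have hLe : letterAvgXEB N U y =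
      ∑ s ∈ Finset.univ.erase s₀, letterWeightR lam s * pathSqWeight U y y s := by linarith
  have hAe : avgXEB 0 U y = ∑ s ∈ Finset.univ.erase s₀, pathSqWeight U y y s := by linarith
  constructor
  · rw [hLe, hAe, Finset.mul_sum]
    exact Finset.sum_le_sum fun s _ =>
      mul_le_mul_of_nonneg_right (pow_le_letterWeightR hμ hlo' s) (pathSqWeight_nonneg U y y s)
  · rw [hLe, hAe, Finset.mul_sum]
    refine Finset.sum_le_sum fun s hs => ?_
    have hs' : s ≠ s₀ := (Finset.mem_erase.1 hs).1
    by_cases hw : pathSqWeight U y y s = 0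
    · rw [hw, mul_zero, mul_zero]
    · exact mul_le_mul_of_nonneg_right
        (letterWeightR_le_pow_of_pathSqWeight_ne_zero h0 h1 hhi hU y y hs' hw) (pathSqWeight_nonneg U y y s)

/-- **(R3) for the depolarizing table is the tree's sandwich** (`λ_min = λ_max = 1 − γ`).
[cite: AharonovEtAl2023, Theorem 4 (proof)] -/
theorem letterXEBSandwich_depolTable {d : ℕ} {U : Fin d → Matrix (ι → Bool) (ι → Bool) ℂ}
    (hU : ∀ t, U t ∈ Matrix.unitaryGroup (ι → Bool) ℂ) (y : ι → Bool) {γ : ℝ} (hγ0 : 0 ≤ γ) (hγ1 : γ ≤ 1) :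
    (1 - γ) ^ (Fintype.card ι * (d + 1)) * avgXEB 0 U y ≤ avgXEB γ U y ∧
      avgXEB γ U y ≤ (1 - γ) ^ (d + 1) * avgXEB 0 U y := by
  rw [← letterAvgXEB_depolarizeAllL γ U y]
  refine letterXEBSandwich (isPauliDiagonal_depolarizeAllL γ) (fun i => if_pos rfl) (by linarith) le_rfl
    (by linarith) (fun i P hP => ?_) (fun i P hP => ?_) hU y
  · simp only [depolTable, if_neg hP, le_refl]
  · simp only [depolTable, if_neg hP, le_refl]

/-! ### (R4) Instances and their validity ranges -/

/-- The eigenvalue table of a single-qubit PAULI LETTER LAW `q = (q_I, q_X, q_Y, q_Z)` (channel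
`M ↦ Σ_Q q_Q σ_Q M σ_Q`): `λ(P) = Σ_Q q_Q · sign(Q,P)` (`pauliLawEig_eq_sum_sign`), i.e.
`λ(I) = Σ q`, `λ(P) = q_I + q_P − q_A − q_B` with `{A, B}` the two letters anticommuting with `P`.
[cite: KempeEtAl2010, §2 (Pauli channels) and Observation 4 (proof: conjugation signs)] -/
def pauliLawEig (q : Pauli → ℝ) : Pauli → ℝ
  | Pauli.I => q Pauli.I + q Pauli.X + q Pauli.Y + q Pauli.Z
  | Pauli.X => q Pauli.I + q Pauli.X - q Pauli.Y - q Pauli.Z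
  | Pauli.Y => q Pauli.I - q Pauli.X + q Pauli.Y - q Pauli.Z
  | Pauli.Z => q Pauli.I - q Pauli.X - q Pauli.Y + q Pauli.Z

/-- The table is the conjugation-sign average `Σ_Q q_Q sign(Q,P)` of the tree (`Pauli.sign`).
[cite: KempeEtAl2010, Observation 4 (proof)] -/
theorem pauliLawEig_eq_sum_sign (q : Pauli → ℝ) (P : Pauli) :
    ((pauliLawEig q P : ℝ) : ℂ) = ∑ Q, (q Q : ℂ) * Pauli.sign Q P := by
  rw [Pauli.sum_univ]
  cases P <;> simp [pauliLawEig, Pauli.sign] <;> ring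

/-- **Validity range of (R3) for Pauli letter laws** (`Σ q = 1`): `λ(I) = 1`,
`λ(X) = 1 − 2(q_Y + q_Z)`, `λ(Y) = 1 − 2(q_X + q_Z)`, `λ(Z) = 1 − 2(q_X + q_Y)`; hence for a
nonnegative law `λ(P) ≤ 1` always, and `0 ≤ λ(P)` iff the anticommuting pair has mass `≤ 1/2` (a
biased law with flip mass `> 1/2` on a pair falls OUT of (R3)); pure dephasing `q = (1−p, 0, 0, p)`
has `λ(Z) = 1` (the (R3) ceiling is vacuous) and `λ(X) = λ(Y) = 1 − 2p`.
[cite: KempeEtAl2010, §2 (Pauli channels)] -/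
theorem pauliLawEig_explicit (q : Pauli → ℝ) (hq : ∑ Q, q Q = 1) :
    pauliLawEig q Pauli.I = 1 ∧ pauliLawEig q Pauli.X = 1 - 2 * (q Pauli.Y + q Pauli.Z) ∧
      pauliLawEig q Pauli.Y = 1 - 2 * (q Pauli.X + q Pauli.Z) ∧
        pauliLawEig q Pauli.Z = 1 - 2 * (q Pauli.X + q Pauli.Y) ∧
          (0 ≤ pauliLawEig q Pauli.Z ↔ q Pauli.X + q Pauli.Y ≤ 1 / 2) := by
  rw [Pauli.sum_univ] at hq
  simp only [pauliLawEig]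
  refine ⟨by linarith, by linarith, by linarith, by linarith, ?_⟩
  constructor <;> intro h <;> linarith

/-- **Numbers (R4)**: at total flip mass `e = 10⁻²` per site and layer, the depolarizing law
(`q_X = q_Y = q_Z = e/3`) has `λ = 1 − 4e/3 < 0.98667`, a `Z`-biased law `(q_X, q_Y, q_Z) =
(10⁻³, 10⁻³, 8·10⁻³)` has `λ_max = λ(Z) = 0.996` and `λ_min = 0.982`; over `d + 1 = 24` layers the
(R3) ceilings are `0.98667^24 < 0.725` (depolarizing) vs `0.996^24 > 0.908` (biased: the WEAKER
statement at equal flip mass), and the floor `λ_min^{n(d+1)}` at `n = 50` is below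
`(0.982^40)^30 < 2^{-30} < 10⁻⁹` (positivity-grade). [cite: AharonovEtAl2023, Theorem 4] -/
theorem letterSandwich_numbers :
    (1 : ℝ) - 4 * (1 / 100) / 3 < 0.98667 ∧ (0.98667 : ℝ) ^ 24 < 0.725 ∧
      (1 : ℝ) - 2 * (1 / 1000 + 1 / 1000) = 0.996 ∧ (0.908 : ℝ) < 0.996 ^ 24 ∧
        (1 : ℝ) - 2 * (1 / 1000 + 8 / 1000) = 0.982 ∧ (0.982 : ℝ) ^ 40 < 1 / 2 ∧
          (1 / 2 : ℝ) ^ 30 < 1 / 10 ^ 9 := by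
  norm_num

end LetterXEB

/-! ### (R4b) The tree's heterogeneous Pauli noise layer is Pauli-diagonal -/

section PauliNoiseInstance

open EntropyCeiling

variable {κ : Type} [Fintype κ] [DecidableEq κ]

/-- The heterogeneous Pauli noise layer `EntropyCeiling.pauliNoiseAll` as a linear map.
[cite: KempeEtAl2010, §2 (Pauli channels)] -/
def pauliNoiseAllL (qs : κ → Pauli → ℂ) :
    Matrix (κ → Bool) (κ → Bool) ℂ →ₗ[ℂ] Matrix (κ → Bool) (κ → Bool) ℂ where
  toFun := pauliNoiseAll qs
  map_add' M M' := pauliNoiseList_add qs _ M M'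
  map_smul' c M := by rw [RingHom.id_apply]; exact pauliNoiseList_smul qs _ c M

/-- Unfolding. [cite: KempeEtAl2010, §2 (Pauli channels)] -/
theorem pauliNoiseAllL_apply (qs : κ → Pauli → ℂ) (M : Matrix (κ → Bool) (κ → Bool) ℂ) :
    pauliNoiseAllL qs M = pauliNoiseAll qs M := rfl

/-- Pauli coefficients through a list of Pauli noise wires pick up the product of the per-wire sign
averages. [cite: KempeEtAl2010, Observation 4 (proof)] -/
theorem pauliCoeff_pauliNoiseList (qs : κ → Pauli → ℂ) (L : List κ) (M : Matrix (κ → Bool) (κ → Bool) ℂ)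
    (S : κ → Pauli) :
    pauliCoeff (pauliNoiseList qs L M) S =
      (L.map fun j => ∑ Q, qs j Q * Pauli.sign Q (S j)).prod * pauliCoeff M S := by
  induction L generalizing M with
  | nil => simp [pauliNoiseList_nil]
  | cons j L ih =>
    rw [pauliNoiseList_cons, ih, pauliCoeff_pauliNoiseWire, List.map_cons, List.prod_cons]
    ring

/-- **Instance: the heterogeneous Pauli noise layer with real letter laws `qs j` is Pauli-diagonal**
with table `λ_j = pauliLawEig (qs j)` — so (R1)–(R3) apply to it, with the validity range of
`pauliLawEig_explicit`. [cite: KempeEtAl2010, §2 (Pauli channels) and Observation 4] -/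
theorem isPauliDiagonal_pauliNoiseAllL (qs : κ → Pauli → ℝ) :
    IsPauliDiagonal (pauliNoiseAllL fun j Q => (qs j Q : ℂ)) (tableC fun j => pauliLawEig (qs j)) := by
  intro M T
  rw [pauliNoiseAllL_apply, ← pauliCoeff_eq, ← pauliCoeff_eq, pauliNoiseAll, pauliCoeff_pauliNoiseList]
  congr 1
  rw [Finset.prod_map_toList]
  exact Finset.prod_congr rfl fun j _ => (pauliLawEig_eq_sum_sign (qs j) (T j)).symm

end PauliNoiseInstance

section LetterTruncation

/-! ### Letter truncation tail (cell `qa-dq`, line `letter-truncation-tail`, L-cand-24)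

HONEST SCOPE. Bounds on the low-weight truncation error of the HONEST letter-noisy value
`Tr(O·N(E_d(C)))` for a Pauli-diagonal noise layer `N` (product table `λ`), summed over the uniform
Pauli-frame orbit of one skeleton — the tree's AGLLV §3.1 chain (`FrameAvgL2`, `FrameBadFraction` in
`PauliPathL2Window`) with the depolarizing damping `(1−γ)^{2(ℓ+1)}` replaced by the letter envelope
`ν^{2(ℓ+1)}`, `ν := max_{i, P ≠ I} |λ_i(P)|`. Only ABSOLUTE VALUES of the table enter, so Pauli letter laws
with a negative eigenvalue (flip mass `> 1/2` on an anticommuting pair) are inside these records (unlike the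
XEB sandwich R3). Pure dephasing (`|λ_Z| = 1`) makes the envelope VACUOUS (`ν = 1`). A counting /
averaging inequality over the frame orbit: it names no good member, describes no estimator or sampler and
builds nothing; nothing here proves or refutes a quantum-advantage conjecture. -/

variable (N : Matrix (ι → Bool) (ι → Bool) ℂ →ₗ[ℂ] Matrix (ι → Bool) (ι → Bool) ℂ)

/-- The low-weight truncation of the letter-noisy value: `q̄_N(C) := Σ_{|s| ≤ ℓ} chanCoeff N (C, s)`
(the tree's `truncValue` with the depolarizing damping replaced by the letter coefficients).
[cite: AharonovEtAl2023, §3 (display defining q̄(C,x))] -/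
noncomputable def letterTruncValue (ℓ : ℕ) {d : ℕ} (U : Fin d → Matrix (ι → Bool) (ι → Bool) ℂ)
    (ρ O : Matrix (ι → Bool) (ι → Bool) ℂ) : ℂ :=
  ∑ s ∈ Finset.univ.filter (fun s : Fin (d + 1) → ι → Pauli => pathWeight s ≤ ℓ),
    chanCoeff N U ρ (obsFun O) s

variable {N}

/-- (LT1) **The letter truncation error lives on the high-weight paths**:
`Tr(O·N(E_d(C))) − q̄_N(C) = Σ_{|s|>ℓ} λ^s f(C,s)`.
[cite: AharonovEtAl2023, §3.1 (E[Δ²] chain, second line: p̃ − q̄ = Σ_{|s|>ℓ} f̃)] -/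
theorem chanValue_sub_letterTruncValue {lam : ι → Pauli → ℂ} (hN : IsPauliDiagonal N lam) (ℓ : ℕ)
    {d : ℕ} (U : Fin d → Matrix (ι → Bool) (ι → Bool) ℂ) (ρ O : Matrix (ι → Bool) (ι → Bool) ℂ) :
    chanValue N U ρ O - letterTruncValue N ℓ U ρ O =
      ∑ s ∈ Finset.univ.filter (fun s : Fin (d + 1) → ι → Pauli => ¬ pathWeight s ≤ ℓ),
        letterWeight lam s * pathCoeff 0 U ρ O s := by
  rw [chanValue_eq_sum_letterWeight_mul_pathCoeff hN, letterTruncValue,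
    Finset.sum_congr rfl fun s _ => chanCoeff_eq_letterWeight_mul_pathCoeff hN U ρ O s,
    ← Finset.sum_filter_add_sum_filter_not Finset.univ
      (fun s : Fin (d + 1) → ι → Pauli => pathWeight s ≤ ℓ)]
  ring

/-- The framed observable of a Hermitian observable is Hermitian.
[cite: AharonovEtAl2023, Definition 3 (final layer of the frame)] -/
theorem conjTranspose_frameObs {d : ℕ} {O : Matrix (ι → Bool) (ι → Bool) ℂ} (hO : Oᴴ = O)
    (W : Fin (d + 1) → ι → Pauli) : (frameObs O W)ᴴ = frameObs O W := by
  simp only [frameObs, Matrix.conjTranspose_mul, conjTranspose_pauliString, hO, Matrix.mul_assoc]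

/-- The framed letter truncation error as a weighted path sum with the high-weight letter profile.
[cite: AharonovEtAl2023, §3.1 (E[Δ²] chain, second line)] -/
theorem chanValue_sub_letterTruncValue_frame {lam : ι → Pauli → ℂ} (hN : IsPauliDiagonal N lam)
    (ℓ : ℕ) {d : ℕ} (U : Fin d → Matrix (ι → Bool) (ι → Bool) ℂ) (ρ O : Matrix (ι → Bool) (ι → Bool) ℂ)
    (W : Fin (d + 1) → ι → Pauli) :
    chanValue N (frameLayers U W) ρ (frameObs O W) - letterTruncValue N ℓ (frameLayers U W) ρ (frameObs O W) =
      ∑ s, (if pathWeight s ≤ ℓ then 0 else letterWeight lam s) *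
        pathCoeff 0 (frameLayers U W) ρ (frameObs O W) s := by
  rw [chanValue_sub_letterTruncValue hN, Finset.sum_filter]
  refine Finset.sum_congr rfl fun s _ => ?_
  by_cases h : pathWeight s ≤ ℓ <;> simp [h]

/-- (LT2) **Frame ℓ²-identity for the letter truncation error** (Hermitian `ρ`, `O`, real table):
`Σ_W ‖Tr(O_W·N(E_d(C_W))) − q̄_N(C_W)‖² = (4ⁿ)^{d+1} Σ_{|s|>ℓ} (λ^s)² f(C,s)²`.
[cite: AharonovEtAl2023, §3.1 (E[Δ²] chain, lines 2–4) and Lemma 3 (orthogonality over the frames)] -/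
theorem sum_frame_norm_sq_letterTruncError {lam : ι → Pauli → ℝ} (hN : IsPauliDiagonal N (tableC lam))
    (ℓ : ℕ) {d : ℕ} (U : Fin d → Matrix (ι → Bool) (ι → Bool) ℂ) {ρ O : Matrix (ι → Bool) (ι → Bool) ℂ}
    (hρ : ρᴴ = ρ) (hO : Oᴴ = O) :
    ∑ W : Fin (d + 1) → ι → Pauli, ‖chanValue N (frameLayers U W) ρ (frameObs O W) -
        letterTruncValue N ℓ (frameLayers U W) ρ (frameObs O W)‖ ^ 2 =
      ((4 : ℝ) ^ Fintype.card ι) ^ (d + 1) *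
        ∑ s ∈ Finset.univ.filter (fun s : Fin (d + 1) → ι → Pauli => ¬ pathWeight s ≤ ℓ),
          letterWeightR lam s ^ 2 * ‖pathCoeff 0 U ρ O s‖ ^ 2 := by
  classical
  set a : (Fin (d + 1) → ι → Pauli) → ℂ := fun s => if pathWeight s ≤ ℓ then 0 else letterWeight (tableC lam) s
    with ha
  -- realness of each framed error
  have hreal : ∀ W : Fin (d + 1) → ι → Pauli,
      (starRingEnd ℂ) (chanValue N (frameLayers U W) ρ (frameObs O W) -
          letterTruncValue N ℓ (frameLayers U W) ρ (frameObs O W)) =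
        chanValue N (frameLayers U W) ρ (frameObs O W) -
          letterTruncValue N ℓ (frameLayers U W) ρ (frameObs O W) := by
    intro W
    rw [chanValue_sub_letterTruncValue_frame hN, map_sum]
    refine Finset.sum_congr rfl fun s _ => ?_
    rw [map_mul, conj_pathCoeff_zero _ hρ (conjTranspose_frameObs hO W)]
    congr 1
    by_cases h : pathWeight s ≤ ℓ
    · simp [h]
    · simp [h, letterWeight_tableC]
  -- the complex identity from bilinear frame orthogonality
  have hC : ∑ W : Fin (d + 1) → ι → Pauli,
      (chanValue N (frameLayers U W) ρ (frameObs O W) - letterTruncValue N ℓ (frameLayers U W) ρ (frameObs O W)) ^ 2 =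
      ((4 : ℂ) ^ Fintype.card ι) ^ (d + 1) * ∑ s, a s * a s * (pathCoeff 0 U ρ O s * pathCoeff 0 U ρ O s) := by
    rw [← sum_frame_wsum_mul_wsum_pathCoeff 0 0 a a U ρ O O]
    refine Finset.sum_congr rfl fun W _ => ?_
    rw [sq, chanValue_sub_letterTruncValue_frame hN]
  -- convert to reals
  have hlhs : ∑ W : Fin (d + 1) → ι → Pauli,
      (chanValue N (frameLayers U W) ρ (frameObs O W) - letterTruncValue N ℓ (frameLayers U W) ρ (frameObs O W)) ^ 2 =
      ((∑ W : Fin (d + 1) → ι → Pauli, ‖chanValue N (frameLayers U W) ρ (frameObs O W) -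
        letterTruncValue N ℓ (frameLayers U W) ρ (frameObs O W)‖ ^ 2 : ℝ) : ℂ) := by
    rw [Complex.ofReal_sum]
    exact Finset.sum_congr rfl fun W _ => sq_eq_ofReal_norm_sq₃ (hreal W)
  have hrhs : ∑ s, a s * a s * (pathCoeff 0 U ρ O s * pathCoeff 0 U ρ O s) =
      ((∑ s ∈ Finset.univ.filter (fun s : Fin (d + 1) → ι → Pauli => ¬ pathWeight s ≤ ℓ),
          letterWeightR lam s ^ 2 * ‖pathCoeff 0 U ρ O s‖ ^ 2 : ℝ) : ℂ) := by
    rw [Complex.ofReal_sum, Finset.sum_filter]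
    refine Finset.sum_congr rfl fun s _ => ?_
    by_cases h : pathWeight s ≤ ℓ
    · simp [ha, h]
    · simp only [ha, h, if_false, if_true, not_false_eq_true]
      rw [← sq (pathCoeff 0 U ρ O s), sq_eq_ofReal_norm_sq₃ (conj_pathCoeff_zero U hρ hO s),
        letterWeight_tableC]
      push_cast; ring
  have h := hC
  rw [hlhs, hrhs] at h
  exact_mod_cast h

omit [DecidableEq ι] in
/-- (LT3a) **Letter envelope on one path**: if `|λ_i(I)| ≤ 1` and `|λ_i(P)| ≤ ν` for `P ≠ I` (with
`0 ≤ ν ≤ 1`), then `(λ^s)² ≤ (ν²)^{|s|}` — only absolute values of the table enter.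
[cite: AharonovEtAl2023, §3.1 (display after the chain: the damping (1−γ)^{2|s|} of a weight-|s| path)] -/
theorem letterWeightR_sq_le_pow {lam : ι → Pauli → ℝ} {ν : ℝ} (hν0 : 0 ≤ ν)
    (hI : ∀ i, |lam i Pauli.I| ≤ 1) (hP : ∀ i P, P ≠ Pauli.I → |lam i P| ≤ ν) {d : ℕ}
    (s : Fin (d + 1) → ι → Pauli) : letterWeightR lam s ^ 2 ≤ (ν ^ 2) ^ pathWeight s := by
  classical
  have key : letterWeightR lam s ^ 2 ≤ letterWeightR (depolTable (ι := ι) (1 - ν ^ 2)) s := by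
    unfold letterWeightR
    rw [← Finset.prod_pow]
    refine Finset.prod_le_prod (fun t _ => by positivity) fun t _ => ?_
    rw [← Finset.prod_pow]
    refine Finset.prod_le_prod (fun i _ => by positivity) fun i _ => ?_
    by_cases h : s t i = Pauli.I
    · rw [h]; simp only [depolTable, if_true]
      have := hI i
      rw [← sq_abs]; nlinarith [abs_nonneg (lam i Pauli.I)]
    · simp only [depolTable, h, if_false, sub_sub_cancel]
      have := hP i (s t i) h
      rw [← sq_abs]; nlinarith [abs_nonneg (lam i (s t i))]
  rw [letterWeightR_depolTable, sub_sub_cancel] at key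
  exact key

/-- (LT3) **Frame-averaged ℓ²-error of the letter truncation, assumption-free envelope**: unitary layers,
Hermitian Pauli-bounded input (`c`), Hermitian observable, a Pauli-diagonal layer with real product table
satisfying `|λ_i(I)| ≤ 1`, `|λ_i(P)| ≤ ν ≤ 1` (`P ≠ I`), any `ℓ`:
`Σ_W ‖Tr(O_W·N(E_d(C_W))) − q̄_N(C_W)‖² ≤ 4^{n(d+1)} · ν^{2(ℓ+1)} · c‖O‖_F²` — the tree's `FrameAvgL2` with
`(1−γ) ↦ ν`. Negative eigenvalues are allowed (only `|λ|` enters); `ν = 1` (e.g. pure dephasing) is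
VACUOUS. A statement about the frame SUM for the honest noisy value; it names no good member, describes
no estimator and claims no runtime.
[cite: AharonovEtAl2023, §3.1 (the E_C[Δ²] chain via Lemma 3) with Definition 3 (the Pauli-frame ensemble)] -/
theorem letterFrameAvgL2 {lam : ι → Pauli → ℝ} (hN : IsPauliDiagonal N (tableC lam)) {ν : ℝ}
    (hν0 : 0 ≤ ν) (hν1 : ν ≤ 1) (hI : ∀ i, |lam i Pauli.I| ≤ 1) (hP : ∀ i P, P ≠ Pauli.I → |lam i P| ≤ ν)
    (ℓ : ℕ) {d : ℕ} {U : Fin d → Matrix (ι → Bool) (ι → Bool) ℂ}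
    (hU : ∀ t, U t ∈ Matrix.unitaryGroup (ι → Bool) ℂ) {ρ O : Matrix (ι → Bool) (ι → Bool) ℂ}
    (hρH : ρᴴ = ρ) (hOH : Oᴴ = O) {c : ℝ} (hρ : ∀ S : ι → Pauli, ‖(pauliString S * ρ).trace‖ ^ 2 ≤ c) :
    ∑ W : Fin (d + 1) → ι → Pauli, ‖chanValue N (frameLayers U W) ρ (frameObs O W) -
        letterTruncValue N ℓ (frameLayers U W) ρ (frameObs O W)‖ ^ 2 ≤
      ((4 : ℝ) ^ Fintype.card ι) ^ (d + 1) * ((ν ^ 2) ^ (ℓ + 1) * (c * frobSq O)) := by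
  rw [sum_frame_norm_sq_letterTruncError hN ℓ U hρH hOH]
  refine mul_le_mul_of_nonneg_left ?_ (by positivity)
  set T := Finset.univ.filter (fun s : Fin (d + 1) → ι → Pauli => ¬ pathWeight s ≤ ℓ) with hT
  calc ∑ s ∈ T, letterWeightR lam s ^ 2 * ‖pathCoeff 0 U ρ O s‖ ^ 2
      ≤ ∑ s ∈ T, (ν ^ 2) ^ (ℓ + 1) * ‖pathCoeff 0 U ρ O s‖ ^ 2 := by
        refine Finset.sum_le_sum fun s hs => mul_le_mul_of_nonneg_right ?_ (by positivity)
        have hℓ : ℓ + 1 ≤ pathWeight s := Nat.lt_of_not_le (Finset.mem_filter.1 hs).2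
        exact (letterWeightR_sq_le_pow hν0 hI hP s).trans
          (pow_le_pow_of_le_one (by positivity) (by nlinarith) hℓ)
    _ = (ν ^ 2) ^ (ℓ + 1) * ∑ s ∈ T, ‖pathCoeff 0 U ρ O s‖ ^ 2 := by rw [Finset.mul_sum]
    _ ≤ (ν ^ 2) ^ (ℓ + 1) * (c * frobSq O) :=
        mul_le_mul_of_nonneg_left
          ((Finset.sum_le_univ_sum_of_nonneg fun s => by positivity).trans
            (PauliPathL2Window.sum_norm_sq_pathCoeff_zero_le d U hU ρ O c hρ)) (by positivity)

/-- (LT3') **Bad-frame count (Markov) for the letter truncation**: for every `t ≥ 0`,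
`#{W : ‖err_W‖ ≥ t} · t² ≤ 4^{n(d+1)} ν^{2(ℓ+1)} c‖O‖_F²` — the tree's `FrameBadFraction` with `(1−γ) ↦ ν`.
A counting inequality over the frame orbit of one skeleton; it names no good member and builds nothing.
[cite: AharonovEtAl2023, §3.1 (Markov step after the E_C[Δ²] chain)] -/
theorem letterFrameBadFraction {lam : ι → Pauli → ℝ} (hN : IsPauliDiagonal N (tableC lam)) {ν : ℝ}
    (hν0 : 0 ≤ ν) (hν1 : ν ≤ 1) (hI : ∀ i, |lam i Pauli.I| ≤ 1) (hP : ∀ i P, P ≠ Pauli.I → |lam i P| ≤ ν)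
    (ℓ : ℕ) {d : ℕ} {U : Fin d → Matrix (ι → Bool) (ι → Bool) ℂ}
    (hU : ∀ t, U t ∈ Matrix.unitaryGroup (ι → Bool) ℂ) {ρ O : Matrix (ι → Bool) (ι → Bool) ℂ}
    (hρH : ρᴴ = ρ) (hOH : Oᴴ = O) {c : ℝ} (hρ : ∀ S : ι → Pauli, ‖(pauliString S * ρ).trace‖ ^ 2 ≤ c)
    {t : ℝ} (ht : 0 ≤ t) :
    ((Finset.univ.filter fun W : Fin (d + 1) → ι → Pauli =>
        t ≤ ‖chanValue N (frameLayers U W) ρ (frameObs O W) -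
          letterTruncValue N ℓ (frameLayers U W) ρ (frameObs O W)‖).card : ℝ) * t ^ 2 ≤
      ((4 : ℝ) ^ Fintype.card ι) ^ (d + 1) * ((ν ^ 2) ^ (ℓ + 1) * (c * frobSq O)) := by
  refine le_trans ?_ (letterFrameAvgL2 hN hν0 hν1 hI hP ℓ hU hρH hOH hρ)
  set e : (Fin (d + 1) → ι → Pauli) → ℝ := fun W => ‖chanValue N (frameLayers U W) ρ (frameObs O W) -
    letterTruncValue N ℓ (frameLayers U W) ρ (frameObs O W)‖ with he
  rw [← nsmul_eq_mul, ← Finset.sum_const]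
  calc ∑ _W ∈ Finset.univ.filter (fun W : Fin (d + 1) → ι → Pauli => t ≤ e W), t ^ 2
      ≤ ∑ W ∈ Finset.univ.filter (fun W : Fin (d + 1) → ι → Pauli => t ≤ e W), e W ^ 2 :=
        Finset.sum_le_sum fun W hW => pow_le_pow_left₀ ht (Finset.mem_filter.1 hW).2 2
    _ ≤ ∑ W : Fin (d + 1) → ι → Pauli, e W ^ 2 :=
        Finset.sum_le_univ_sum_of_nonneg fun W => by positivity

/-! #### Instances of the envelope -/

/-- The depolarizing layer: the letter truncation IS the tree's `truncValue`, and the envelope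
hypotheses hold with `ν = 1 − γ` (`0 ≤ γ ≤ 1`) — so (LT3) returns the tree's `FrameAvgL2` verbatim.
[cite: AharonovEtAl2023, §3 (display defining q̄) and §3.1] -/
theorem letterTruncValue_depolarizeAllL (γ : ℝ) (ℓ : ℕ) {d : ℕ} (U : Fin d → Matrix (ι → Bool) (ι → Bool) ℂ)
    (ρ O : Matrix (ι → Bool) (ι → Bool) ℂ) :
    letterTruncValue (depolarizeAllL (γ : ℂ)) ℓ U ρ O = truncValue (γ : ℂ) ℓ U ρ O ∧
      ((0 ≤ γ → γ ≤ 1 →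
        (∀ i : ι, |depolTable (ι := ι) γ i Pauli.I| ≤ 1) ∧
          ∀ (i : ι) (P : Pauli), P ≠ Pauli.I → |depolTable (ι := ι) γ i P| ≤ 1 - γ)) := by
  refine ⟨?_, fun h0 h1 => ⟨fun i => by simp [depolTable], fun i P hP => ?_⟩⟩
  · unfold letterTruncValue truncValue
    refine Finset.sum_congr rfl fun s _ => ?_
    rw [chanCoeff_eq_letterWeight_mul_pathCoeff (isPauliDiagonal_depolarizeAllL γ) U ρ O s,
      letterWeight_tableC, letterWeightR_depolTable, pathCoeff_eq_pow_mul_pathCoeff_zero (γ : ℂ)]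
    push_cast; ring
  · simp only [depolTable, hP, if_false]
    rw [abs_of_nonneg (by linarith)]

/-- A single-qubit Pauli letter LAW (`q ≥ 0`, `Σ q = 1`) has all eigenvalues in `[−1, 1]`
(`λ(P) = 1 − 2(q_A + q_B)`), so `|λ(I)| = 1 ≤ 1` and the envelope parameter is
`ν = max_{P ≠ I} |1 − 2(q_A + q_B)|` — laws with flip mass `> 1/2` on a pair (negative `λ`) included.
[cite: KempeEtAl2010, §2 (Pauli channels: eigenvalues are differences of probabilities, in [−1,1])] -/
theorem abs_pauliLawEig_le_one (q : Pauli → ℝ) (hq0 : ∀ Q, 0 ≤ q Q) (hq : ∑ Q, q Q = 1) (P : Pauli) :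
    |pauliLawEig q P| ≤ 1 := by
  have hs : q Pauli.I + q Pauli.X + q Pauli.Y + q Pauli.Z = 1 := by
    rw [← hq, Pauli.sum_univ]
  have hI := hq0 Pauli.I; have hX := hq0 Pauli.X; have hY := hq0 Pauli.Y; have hZ := hq0 Pauli.Z
  rw [abs_le]
  cases P <;> simp only [pauliLawEig] <;> constructor <;> linarith

/-- **Numbers for the envelope** (`norm_num`; statements about the typed BOUND (LT3), not about any
algorithm's cost): to push the tail factor `ν^{2(ℓ+1)}` below `10⁻²`, truncation degree `ℓ + 1 = 172`
suffices at `ν ≤ 0.98667` (depolarizing with flip mass `10⁻²` per site·layer: `0.98667^{344} < 10⁻²`),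
whereas for the `Z`-biased law `(10⁻³, 10⁻³, 8·10⁻³)` (`ν = λ_Z = 0.996`, same flip mass) even
`ℓ + 1 = 500` does not (`0.996^{1000} > 10⁻²`): at equal flip mass the envelope certifies a `> 2.9×`
higher degree for the biased letter.
[cite: AharonovEtAl2023, §3.1 (choice of ℓ = O(log(1/ε)/γ) after the chain)] -/
theorem letterTail_numbers :
    ((0.98667 : ℝ) ^ 8 < 0.8983 ∧ (0.8983 : ℝ) ^ 43 < 1 / 100 ∧ (0.98667 : ℝ) ^ 344 < 1 / 100) ∧
      ((0.851 : ℝ) < 0.996 ^ 40 ∧ (1 / 100 : ℝ) < 0.851 ^ 25 ∧ (1 / 100 : ℝ) < 0.996 ^ 1000) := by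
  have a1 : (0.98667 : ℝ) ^ 8 < 0.8983 := by norm_num
  have a2 : (0.8983 : ℝ) ^ 43 < 1 / 100 := by norm_num
  have b1 : (0.851 : ℝ) < 0.996 ^ 40 := by norm_num
  have b2 : (1 / 100 : ℝ) < 0.851 ^ 25 := by norm_num
  refine ⟨⟨a1, a2, ?_⟩, ⟨b1, b2, ?_⟩⟩
  · calc (0.98667 : ℝ) ^ 344 = ((0.98667 : ℝ) ^ 8) ^ 43 := by rw [← pow_mul]
      _ < 0.8983 ^ 43 := pow_lt_pow_left₀ a1 (by positivity) (by norm_num)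
      _ < 1 / 100 := a2
  · calc (1 / 100 : ℝ) < 0.851 ^ 25 := b2
      _ < (0.996 ^ 40) ^ 25 := pow_lt_pow_left₀ b1 (by norm_num) (by norm_num)
      _ = 0.996 ^ 1000 := by rw [← pow_mul]

/-! #### The low-noise FLOOR of the same frame sum (the other side of the window)

HONEST SCOPE (line `letter-truncation-floor`, L-cand-25; additions-only to the landed §). The exact identity (LT2) read from BELOW: with `1 ≤ |λ_i(I)|` and
`μ ≤ |λ_i(P)|` (`P ≠ I`) the frame-summed squared truncation error is at least
`4^{n(d+1)} μ^{2n(d+1)} · M_{>ℓ}(C)`, `M_{>ℓ}(C) := Σ_{|s|>ℓ} ‖f(C,s)‖²` the IDEAL high-weight path mass of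
the skeleton. This is a limitation statement about the typed truncation at letter rates `1 − μ = O(1/(n d))`
— it says what the truncation cannot do on the frame orbit; it is not a hardness or advantage claim, names no
circuit family with large `M_{>ℓ}`, and builds nothing. -/

omit [DecidableEq ι] in
/-- (LT6a) **Letter floor on one path**: if `1 ≤ |λ_i(I)|` and `μ ≤ |λ_i(P)|` for `P ≠ I` (`0 ≤ μ`), then
`(μ²)^{|s|} ≤ (λ^s)²`. [cite: AharonovEtAl2023, §3.1 (the weight-|s| damping (1−γ)^{2|s|}, read from below)] -/
theorem pow_le_letterWeightR_sq {lam : ι → Pauli → ℝ} {μ : ℝ} (hμ0 : 0 ≤ μ)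
    (hI : ∀ i, 1 ≤ |lam i Pauli.I|) (hP : ∀ i P, P ≠ Pauli.I → μ ≤ |lam i P|) {d : ℕ}
    (s : Fin (d + 1) → ι → Pauli) : (μ ^ 2) ^ pathWeight s ≤ letterWeightR lam s ^ 2 := by
  classical
  have key : letterWeightR (depolTable (ι := ι) (1 - μ ^ 2)) s ≤ letterWeightR lam s ^ 2 := by
    unfold letterWeightR
    rw [← Finset.prod_pow]
    refine Finset.prod_le_prod (fun t _ => Finset.prod_nonneg fun i _ => ?_) fun t _ => ?_
    · by_cases h : s t i = Pauli.I <;> simp [depolTable, h, hμ0]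
    rw [← Finset.prod_pow]
    refine Finset.prod_le_prod (fun i _ => ?_) fun i _ => ?_
    · by_cases h : s t i = Pauli.I <;> simp [depolTable, h, hμ0]
    by_cases h : s t i = Pauli.I
    · rw [h]; simp only [depolTable, if_true]
      have := hI i
      rw [← sq_abs (lam i Pauli.I)]; nlinarith [abs_nonneg (lam i Pauli.I)]
    · simp only [depolTable, h, if_false, sub_sub_cancel]
      have := hP i (s t i) h
      rw [← sq_abs (lam i (s t i))]; nlinarith [abs_nonneg (lam i (s t i))]
  rw [letterWeightR_depolTable, sub_sub_cancel] at key
  exact key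

/-- (LT6) **Low-noise FLOOR of the frame-summed squared truncation error** — the other side of the
window, with NO unitarity or boundedness hypothesis: for a Pauli-diagonal layer with real product table,
`1 ≤ |λ_i(I)|`, `μ ≤ |λ_i(P)|` (`P ≠ I`, `0 ≤ μ ≤ 1`), Hermitian `ρ, O`, every `ℓ`:
`4^{n(d+1)} · μ^{2n(d+1)} · Σ_{|s|>ℓ} ‖f(C,s)‖² ≤ Σ_W ‖Tr(O_W·N(E_d(C_W))) − q̄_N(C_W)‖²`
— on frame average the weight-`ℓ` truncation error is AT LEAST `μ^{2n(d+1)}` times the IDEAL high-weight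
path mass `M_{>ℓ}(C) = Σ_{|s|>ℓ} ‖f(C,s)‖²`.  Reading: at letter rates `1 − μ = O(1/(n(d+1)))` the
truncation cannot be accurate on the frame orbit unless the ideal skeleton's high-weight mass is itself
small — a statement about what the typed truncation CANNOT do (no algorithm is described).
BINDERS. Every Pauli letter law has `λ_i(I) = 1`, so `1 ≤ |λ_i(I)|` holds with equality in every instance —
it is stated because it is the weakest hypothesis the proof uses; likewise only `μ ≤ |λ_i(P)|` (`P ≠ I`)
enters.  LIKE WITH LIKE. The ceiling (LT3) needs unitary layers and the Pauli bound `c` on `ρ` (Bessel,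
`PauliPathL2Window.sum_norm_sq_pathCoeff_zero_le`); the floor needs neither — it is the identity (LT2) plus
`|s| ≤ n(d+1)` (`pathWeight_le`) — so the two sides bound the SAME frame sum under the ceiling's hypotheses.
[cite: AharonovEtAl2023, §3.1 (the chain E_C[Δ²] = Σ_{|s|>ℓ}(1−γ)^{2|s|}E|f|², read as a lower bound)] -/
theorem letterFrameL2Floor {lam : ι → Pauli → ℝ} (hN : IsPauliDiagonal N (tableC lam)) {μ : ℝ}
    (hμ0 : 0 ≤ μ) (hμ1 : μ ≤ 1) (hI : ∀ i, 1 ≤ |lam i Pauli.I|) (hP : ∀ i P, P ≠ Pauli.I → μ ≤ |lam i P|)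
    (ℓ : ℕ) {d : ℕ} (U : Fin d → Matrix (ι → Bool) (ι → Bool) ℂ) {ρ O : Matrix (ι → Bool) (ι → Bool) ℂ}
    (hρH : ρᴴ = ρ) (hOH : Oᴴ = O) :
    ((4 : ℝ) ^ Fintype.card ι) ^ (d + 1) * ((μ ^ 2) ^ (Fintype.card ι * (d + 1)) *
        ∑ s ∈ Finset.univ.filter (fun s : Fin (d + 1) → ι → Pauli => ¬ pathWeight s ≤ ℓ),
          ‖pathCoeff 0 U ρ O s‖ ^ 2) ≤
      ∑ W : Fin (d + 1) → ι → Pauli, ‖chanValue N (frameLayers U W) ρ (frameObs O W) -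
        letterTruncValue N ℓ (frameLayers U W) ρ (frameObs O W)‖ ^ 2 := by
  rw [sum_frame_norm_sq_letterTruncError hN ℓ U hρH hOH, Finset.mul_sum]
  refine mul_le_mul_of_nonneg_left (Finset.sum_le_sum fun s _ => ?_) (by positivity)
  refine mul_le_mul_of_nonneg_right ?_ (by positivity)
  exact (pow_le_pow_of_le_one (by positivity) (by nlinarith) (pathWeight_le s)).trans
    (pow_le_letterWeightR_sq hμ0 hI hP s)

/-- (LT6′) **Band floor**: for every cut-off `w`, `4^{n(d+1)} · (μ²)^{w} · Σ_{ℓ<|s|≤w} ‖f(C,s)‖² ≤ Σ_W ‖err_W‖²`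
— the mass of the ideal skeleton in the weight band `(ℓ, w]` is seen with the factor `μ^{2w}` (sharper than
(LT6) when the band is low); same binders, no unitarity.
[cite: AharonovEtAl2023, §3.1 (the chain read as a lower bound, band by band)] -/
theorem letterFrameL2Floor_band {lam : ι → Pauli → ℝ} (hN : IsPauliDiagonal N (tableC lam)) {μ : ℝ}
    (hμ0 : 0 ≤ μ) (hμ1 : μ ≤ 1) (hI : ∀ i, 1 ≤ |lam i Pauli.I|) (hP : ∀ i P, P ≠ Pauli.I → μ ≤ |lam i P|)
    (ℓ w : ℕ) {d : ℕ} (U : Fin d → Matrix (ι → Bool) (ι → Bool) ℂ) {ρ O : Matrix (ι → Bool) (ι → Bool) ℂ}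
    (hρH : ρᴴ = ρ) (hOH : Oᴴ = O) :
    ((4 : ℝ) ^ Fintype.card ι) ^ (d + 1) * ((μ ^ 2) ^ w *
        ∑ s ∈ Finset.univ.filter (fun s : Fin (d + 1) → ι → Pauli => ¬ pathWeight s ≤ ℓ ∧ pathWeight s ≤ w),
          ‖pathCoeff 0 U ρ O s‖ ^ 2) ≤
      ∑ W : Fin (d + 1) → ι → Pauli, ‖chanValue N (frameLayers U W) ρ (frameObs O W) -
        letterTruncValue N ℓ (frameLayers U W) ρ (frameObs O W)‖ ^ 2 := by
  rw [sum_frame_norm_sq_letterTruncError hN ℓ U hρH hOH, Finset.mul_sum]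
  refine mul_le_mul_of_nonneg_left ?_ (by positivity)
  calc ∑ s ∈ Finset.univ.filter (fun s : Fin (d + 1) → ι → Pauli => ¬ pathWeight s ≤ ℓ ∧ pathWeight s ≤ w),
        (μ ^ 2) ^ w * ‖pathCoeff 0 U ρ O s‖ ^ 2
      ≤ ∑ s ∈ Finset.univ.filter (fun s : Fin (d + 1) → ι → Pauli => ¬ pathWeight s ≤ ℓ ∧ pathWeight s ≤ w),
        letterWeightR lam s ^ 2 * ‖pathCoeff 0 U ρ O s‖ ^ 2 := by
        refine Finset.sum_le_sum fun s hs => mul_le_mul_of_nonneg_right ?_ (by positivity)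
        exact (pow_le_pow_of_le_one (by positivity) (by nlinarith) (Finset.mem_filter.1 hs).2.2).trans
          (pow_le_letterWeightR_sq hμ0 hI hP s)
    _ ≤ ∑ s ∈ Finset.univ.filter (fun s : Fin (d + 1) → ι → Pauli => ¬ pathWeight s ≤ ℓ),
        letterWeightR lam s ^ 2 * ‖pathCoeff 0 U ρ O s‖ ^ 2 :=
        Finset.sum_le_sum_of_subset_of_nonneg
          (fun s hs => Finset.mem_filter.2 ⟨Finset.mem_univ _, (Finset.mem_filter.1 hs).2.1⟩)
          fun s _ _ => by positivity

/-- **Depolarizing instance of the floor** (new for the tree's own `truncValue` as well): for `0 ≤ γ ≤ 1`,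
Hermitian `ρ, O`, any layers, every `ℓ`,
`4^{n(d+1)} · (1−γ)^{2n(d+1)} · Σ_{|s|>ℓ} ‖f(C,s)‖² ≤ Σ_W ‖p̃_W − q̄_ℓ(C_W)‖²` — the tree's `FrameAvgL2`
read from below. [cite: AharonovEtAl2023, §3.1 (E_C[Δ²] chain) with Definition 3] -/
theorem frameL2Floor_depolarizing {γ : ℝ} (h0 : 0 ≤ γ) (h1 : γ ≤ 1) (ℓ : ℕ) {d : ℕ}
    (U : Fin d → Matrix (ι → Bool) (ι → Bool) ℂ) {ρ O : Matrix (ι → Bool) (ι → Bool) ℂ}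
    (hρH : ρᴴ = ρ) (hOH : Oᴴ = O) :
    ((4 : ℝ) ^ Fintype.card ι) ^ (d + 1) * ((((1 - γ) ^ 2) ^ (Fintype.card ι * (d + 1))) *
        ∑ s ∈ Finset.univ.filter (fun s : Fin (d + 1) → ι → Pauli => ¬ pathWeight s ≤ ℓ),
          ‖pathCoeff 0 U ρ O s‖ ^ 2) ≤
      ∑ W : Fin (d + 1) → ι → Pauli, ‖noisyValue (γ : ℂ) (frameLayers U W) ρ (frameObs O W) -
        truncValue (γ : ℂ) ℓ (frameLayers U W) ρ (frameObs O W)‖ ^ 2 := by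
  have h := letterFrameL2Floor (N := depolarizeAllL (γ : ℂ)) (isPauliDiagonal_depolarizeAllL γ)
    (μ := 1 - γ) (by linarith) (by linarith) (fun i => by simp [depolTable])
    (fun i P hP => by simp only [depolTable, hP, if_false]; rw [abs_of_nonneg (by linarith)]) ℓ U hρH hOH
  simpa only [chanValue_depolarizeAllL, (letterTruncValue_depolarizeAllL γ ℓ _ ρ _).1] using h

/-- **Numbers for the floor** (`norm_num`; about the typed FLOOR (LT6)): on `n(d+1) = 1060` sites
(`53 × 20`) a letter table with `μ ≥ 0.998` (flip mass `≤ 10⁻³` per site·layer for a depolarizing-type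
law, `λ = 1 − (4/3)·10⁻³ > 0.998` — indeed any Pauli letter law with flip mass `m ≤ 10⁻³` has
`λ_min ≥ 1 − 2m ≥ 0.998`) has `μ^{2·1060} > 1/72`: the frame-mean squared truncation error is at
least `1.38 %` of the ideal high-weight mass `M_{>ℓ}(C)` at EVERY degree `ℓ`; at `μ ≥ 0.9998` (flip mass
`10⁻⁴`) the factor exceeds `0.65`.
[cite: AharonovEtAl2023, §1 (the regime statement: constant noise rate per gate vs. the 1/n regime)] -/
theorem letterFloor_numbers :
    (0.998 : ℝ) < 1 - 4 / 3 * (1 / 1000) ∧ (1 / 72 : ℝ) < 0.998 ^ 2120 ∧ (0.65 : ℝ) < 0.9998 ^ 2120 := by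
  refine ⟨by norm_num, ?_, ?_⟩
  · have h1 : (0.9227 : ℝ) < 0.998 ^ 40 := by norm_num
    have h2 : (1 / 72 : ℝ) < 0.9227 ^ 53 := by norm_num
    calc (1 / 72 : ℝ) < 0.9227 ^ 53 := h2
      _ < (0.998 ^ 40) ^ 53 := pow_lt_pow_left₀ h1 (by norm_num) (by norm_num)
      _ = 0.998 ^ 2120 := by rw [← pow_mul]
  · have h1 : (0.99203 : ℝ) < 0.9998 ^ 40 := by norm_num
    have h2 : (0.65 : ℝ) < 0.99203 ^ 53 := by norm_num
    calc (0.65 : ℝ) < 0.99203 ^ 53 := h2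
      _ < (0.9998 ^ 40) ^ 53 := pow_lt_pow_left₀ h1 (by norm_num) (by norm_num)
      _ = 0.9998 ^ 2120 := by rw [← pow_mul]

end LetterTruncation

section SandwichDepth

/-! ### Depth forms of the letter sandwich (cell `qa-dq`, line `letter-sandwich-depth-forms`, L-cand-26)

HONEST SCOPE. The landed record (R3) `letterXEBSandwich` — `λ_min^{n(d+1)}·α′ ≤ E_W XEB_N ≤ λ_max^{d+1}·α′`
for the HONEST letter-noisy device's frame-averaged linear XEB score — rewritten in logarithmic (depth)
form, plus numbers at the scale of current certified-randomness proposals (`n ≈ 56–60`).  (S1) is an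
UPPER bound on the depth at which the honest device can still pass a level `χ` on frame average; (S2) a
LOWER bound on its score (it passes `χ` whenever `n(d+1)·ln(1/λ_min) ≤ ln(α′/χ)`).  HONEST WEAKNESS: the
ceiling's exponent is `d + 1` (one letter per layer), so at per-site flip mass `10⁻²` (depolarizing-type
letter law, `λ_max = 1 − (4/3)·10⁻²`) it excludes a score `≥ 0.32·α′` only from `d + 1 ≥ 85` layers — it
is NOT a binding depth limit at experimental depths and must not be cited as one; the floor (exponent `n(d+1)`) is the binding side.  No spoofing statement, no
estimator, sampler or verifier cost claim; nothing here proves or refutes a quantum-advantage conjecture. -/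

variable {N : Matrix (ι → Bool) (ι → Bool) ℂ →ₗ[ℂ] Matrix (ι → Bool) (ι → Bool) ℂ}

/-- (S1) **Depth form of the ceiling** — a log-form COROLLARY of the landed `letterXEBSandwich` (R3), not
a new bound: under R3's hypotheses (`λ_i(I) = 1`, `0 ≤ μ ≤ λ_i(P) ≤ ν` for `P ≠ I`, unitary layers) with
`0 < ν < 1`, if the honest letter-noisy device passes level `χ > 0` on frame average (`χ ≤ E_W XEB_N`),
then `(d+1)·ln(1/ν) ≤ ln(α′/χ)` with `α′ = E_W XEB_0` — here `α′ > 0` is FORCED (`0 < χ ≤ ν^{d+1} α′`).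
See the § docstring for why this is non-binding at experimental depths. [cite: AharonovEtAl2023, Theorem 4 (proof: XEB ≤ λ^{d+1}·α′)] -/
theorem letterXEB_pass_depth_le {lam : ι → Pauli → ℝ} (hN : IsPauliDiagonal N (tableC lam))
    (hI : ∀ i, lam i Pauli.I = 1) {μ ν : ℝ} (hμ : 0 ≤ μ) (hμν : μ ≤ ν) (hν0 : 0 < ν) (hν1 : ν < 1)
    (hlo : ∀ i P, P ≠ Pauli.I → μ ≤ lam i P) (hhi : ∀ i P, P ≠ Pauli.I → lam i P ≤ ν)
    {d : ℕ} {U : Fin d → Matrix (ι → Bool) (ι → Bool) ℂ} (hU : ∀ t, U t ∈ Matrix.unitaryGroup (ι → Bool) ℂ)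
    (y : ι → Bool) {χ : ℝ} (hχ : 0 < χ) (hpass : χ ≤ letterAvgXEB N U y) :
    ((d : ℝ) + 1) * Real.log (1 / ν) ≤ Real.log (avgXEB 0 U y / χ) := by
  have hceil := (letterXEBSandwich hN hI hμ hμν hν1.le hlo hhi hU y).2
  have h1 : χ ≤ ν ^ (d + 1) * avgXEB 0 U y := hpass.trans hceil
  have hνp : 0 < ν ^ (d + 1) := pow_pos hν0 _
  have hα : 0 < avgXEB 0 U y := by
    by_contra h
    push Not at h
    have : ν ^ (d + 1) * avgXEB 0 U y ≤ 0 := mul_nonpos_of_nonneg_of_nonpos hνp.le h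
    linarith
  have h2 : χ / avgXEB 0 U y ≤ ν ^ (d + 1) := by rwa [div_le_iff₀ hα]
  have h3 : Real.log (χ / avgXEB 0 U y) ≤ ((d : ℝ) + 1) * Real.log ν := by
    have := Real.log_le_log (div_pos hχ hα) h2
    rwa [Real.log_pow, Nat.cast_add_one] at this
  rw [one_div, Real.log_inv, Real.log_div hα.ne' hχ.ne']
  rw [Real.log_div hχ.ne' hα.ne'] at h3
  linarith

/-- (S2) **Depth form of the floor** — a log-form COROLLARY of the landed `letterXEBSandwich` (R3) (a LOWER
bound on the honest score, not a new bound): under R3's hypotheses with `0 < μ = λ_min` and `α′ = E_W XEB_0 > 0`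
ASSUMED (the floor is vacuous at `α′ = 0`), if `n(d+1)·ln(1/μ) ≤ ln(α′/χ)` (`χ > 0`) then the honest
letter-noisy device passes level `χ` on frame average: `χ ≤ E_W XEB_N`.
[cite: AharonovEtAl2023, Theorem 4 (proof: lower bound λ^{n(d+1)}·α′ ≤ XEB)] -/
theorem letterXEB_floor_pass {lam : ι → Pauli → ℝ} (hN : IsPauliDiagonal N (tableC lam))
    (hI : ∀ i, lam i Pauli.I = 1) {μ ν : ℝ} (hμ0 : 0 < μ) (hμν : μ ≤ ν) (hν : ν ≤ 1)
    (hlo : ∀ i P, P ≠ Pauli.I → μ ≤ lam i P) (hhi : ∀ i P, P ≠ Pauli.I → lam i P ≤ ν)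
    {d : ℕ} {U : Fin d → Matrix (ι → Bool) (ι → Bool) ℂ} (hU : ∀ t, U t ∈ Matrix.unitaryGroup (ι → Bool) ℂ)
    (y : ι → Bool) (hα : 0 < avgXEB 0 U y) {χ : ℝ} (hχ : 0 < χ)
    (hdepth : (Fintype.card ι * (d + 1) : ℝ) * Real.log (1 / μ) ≤ Real.log (avgXEB 0 U y / χ)) :
    χ ≤ letterAvgXEB N U y := by
  have hfloor := (letterXEBSandwich hN hI hμ0.le hμν hν hlo hhi hU y).1
  refine le_trans ?_ hfloor
  -- `χ ≤ μ^{n(d+1)} α′` from the logarithmic hypothesis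
  have hlog : Real.log χ ≤ Real.log (μ ^ (Fintype.card ι * (d + 1)) * avgXEB 0 U y) := by
    rw [Real.log_mul (pow_pos hμ0 _).ne' hα.ne', Real.log_pow]
    rw [one_div, Real.log_inv, Real.log_div hα.ne' hχ.ne'] at hdepth
    push_cast at hdepth ⊢
    linarith
  exact (Real.log_le_log_iff hχ (mul_pos (pow_pos hμ0 _) hα)).1 hlog

/-- (S3) **Numbers at certified-randomness scale** (`norm_num`): numbers about the typed bounds (R3)/(S1)/(S2)
at a CHOSEN scale `n(d+1) = 616 = 56 × 11`, not about any experiment's data, any device, or any protocol's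
security.  FLOOR: with `λ_min ≥ 0.998` (depolarizing-type law with per-site flip mass `≤ 1.5·10⁻³` per
layer, or ANY Pauli letter law with flip mass `≤ 10⁻³`, since `λ_min ≥ 1 − 2m`) the honest frame-averaged
score keeps at least `29 %` of `α′` (`0.29 < 0.998^{616}`).  CEILING: at `d + 1 = 11` it only excludes scores above `97.8 %` of `α′`
(`0.978 < 0.998^{11}`), and even at flip mass `10⁻²` for a depolarizing-type law (`λ_max = 1 − (4/3)·10⁻² <
0.98667`; a biased law at the same mass has a larger `λ_max` and a weaker ceiling still) it excludes
`≥ 0.32·α′` only from `d + 1 ≥ 85` (`0.98667^{85} < 0.32 < 0.98667^{84}`) — the honest-weakness sentence of the § docstring in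
numbers.  Scale marker only: "n = 60 qubits … in the quantum supremacy regime" is the proposal's phrase.
[cite: AaronsonHung2023, §1.2 (arXiv p. 5: "with n = 60 qubits")] -/
theorem sandwichDepth_numbers :
    (0.29 : ℝ) < 0.998 ^ 616 ∧ (0.978 : ℝ) < 0.998 ^ 11 ∧
      ((0.98667 : ℝ) ^ 85 < 0.32 ∧ (0.32 : ℝ) < 0.98667 ^ 84) := by
  refine ⟨?_, by norm_num, ?_, ?_⟩
  · have h1 : (0.9454 : ℝ) < 0.998 ^ 28 := by norm_num
    have h2 : (0.29 : ℝ) < 0.9454 ^ 22 := by norm_num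
    calc (0.29 : ℝ) < 0.9454 ^ 22 := h2
      _ < (0.998 ^ 28) ^ 22 := pow_lt_pow_left₀ h1 (by norm_num) (by norm_num)
      _ = 0.998 ^ 616 := by rw [← pow_mul]
  · have h1 : (0.98667 : ℝ) ^ 17 < 0.79605 := by norm_num
    have h2 : (0.79605 : ℝ) ^ 5 < 0.32 := by norm_num
    calc (0.98667 : ℝ) ^ 85 = ((0.98667 : ℝ) ^ 17) ^ 5 := by rw [← pow_mul]
      _ < 0.79605 ^ 5 := pow_lt_pow_left₀ h1 (by positivity) (by norm_num)
      _ < 0.32 := h2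
  · have h1 : (0.7544 : ℝ) < 0.98667 ^ 21 := by norm_num
    have h2 : (0.32 : ℝ) < 0.7544 ^ 4 := by norm_num
    calc (0.32 : ℝ) < 0.7544 ^ 4 := h2
      _ < (0.98667 ^ 21) ^ 4 := pow_lt_pow_left₀ h1 (by norm_num) (by norm_num)
      _ = 0.98667 ^ 84 := by rw [← pow_mul]

end SandwichDepth

end PauliPath

end Literature.Computability.QuantumComplexity
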